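import Summits.QuantumFields.QCD.Theses.NestedDissectionSea
import Summits.QuantumFields.QCD.Theorems.EarlyCrosserLaw.Negative.LowerPinLoadBearing
import Literature.MathematicalPhysics.QuantumFieldTheory.QCDGoldstoneBound

/-!
# Crux `LightQuarkCompletion` (stmt-QuantumFields-18066) — line `Sketch`, stub `stub_jumpGerm` (B2a): what is provable

Sorry-free glue extracted from the stub-worker's work file `work/stubs/stub_jumpGerm.lean` (the registered stub itself is
NOT proved here; it is open for `M₀ > 0`).  Worker's analysis (stub-worker B2a, 2026-08-17):

Write `reg₁ := reg.restrict φ` and `reg' :=` `reg₁` re-centred at `J` (`m_crit' = m_crit₁ + a₁ J / Z_m₁`).  Unfolding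
`PinClause`/`UpperPin`, the zero-threshold pin of `reg'` at a positive tuple `m` reads, in the coordinates of `reg₁`:

* weights at the tuple `J + m` (bare trajectories `m_crit₁ + a₁ (J + m_f) / Z_m₁`);
* lower pin masses `m_crit₁ − a₁ (M − J) / Z_m₁`, every `M > 0`, i.e. EVERY depth `M' = M − J > −J`;
* upper pin masses `m_crit₁ + a₁ (M + J) / Z_m₁`, every `M > 0`, i.e. every height `M'' = M + J > J`.

So (transport lemmas `pinClause_transport`, `upperPin_transport`, and `zeroPin_recentre_of` below) the conclusion is
EQUIVALENT to: along `φ`, for every tuple strictly above `J·1` some common `R` with `PinClause Nf reg₁ (−J) (J + m) R`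
and `UpperPin Nf reg₁ J (J + m) R`.  The hypothesis supplies weights only at tuples `> M₀` (forcing `J ≥ M₀`), the
upper pin only at heights `> M₀` (forcing `J ≥ M₀`) and the lower pin only at depths `> M₀` (forcing `−J ≥ M₀`).  Hence
`J = M₀ = 0` is the only instance served by the hypotheses: for `M₀ = 0` the stub holds with `φ = id`, `J = 0`
(`jumpGerm_of_zeroThreshold`); for `M₀ > 0` the best re-centring `J = M₀`, `φ = id` leaves exactly the residual
"lower pin through the band", `PinClause Nf reg (−M₀) m R` in place of `PinClause Nf reg M₀ m R`
(`jumpGerm_of_bandLowerPin`), which no hypothesis and no tree item addresses for the GIVEN `reg` (the route items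
`EarlyCrosserLaw`/`CoerciveSea` are `∃ reg` statements at their own threshold).  The clauses at different depths /
indices are integrals of different indicator functions against different measures; they never interact logically.
-/

noncomputable section

namespace Summit.QuantumFields.QCD.Theorems.LightQuarkJumpLine

open MeasureTheory Filter Topology
open Literature.MathematicalPhysics.QuantumFieldTheory Literature.MathematicalPhysics.QuantumLattice
  Literature.Probability.LatticeModels
open Summit.QuantumFields.QCD.Theorems.CoerciveSeaNegative (PinClause tendsto_a_div_Zm massExponent_pos)
open Summit.QuantumFields.QCD.Theorems.EarlyCrosserLawNegative (UpperPin)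

/-! ## Transport of the two pins under a change of pinning coordinates -/

section Transport

variable {Nf : ℕ} {reg reg' : QCDRegularisation Nf} {M₀ M₀' : ℝ} {m m' : Fin Nf → ℝ} {R : ℝ}

/-- **Transport of the lower pin (b).**  If `reg'` has the spacings and couplings of `reg`, the same bare weight
trajectories (`m_crit' + a m'_f / Z_m' = m_crit + a m_f / Z_m`) and its lower pin masses are those of `reg` read
`c` deeper in RGI units (`m_crit' − a M / Z_m' = m_crit − a (M − c) / Z_m`), then the lower pin of `reg` above `M₀`
(weights `m`) is the lower pin of `reg'` above every `M₀' ≥ M₀ + c` (weights `m'`): clause by clause the same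
phase-quenched ratio. -/
theorem pinClause_transport (h : PinClause Nf reg M₀ m R) (c : ℝ) (ha : ∀ k, reg'.a k = reg.a k)
    (hβ : ∀ k, reg'.β k = reg.β k)
    (hw : ∀ k f, reg'.mcrit k + reg'.a k * m' f / reg'.Zm k = reg.mcrit k + reg.a k * m f / reg.Zm k)
    (hμ : ∀ k M, reg'.mcrit k - reg'.a k * M / reg'.Zm k = reg.mcrit k - reg.a k * (M - c) / reg.Zm k)
    (hc : M₀ + c ≤ M₀') : PinClause Nf reg' M₀' m' R := by
  intro M hM
  have hM' : M₀ < M - c := by linarith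
  filter_upwards [h (M - c) hM'] with k hk S hS
  have hS' : R ≤ reg.a k * (2 * S + 1) := by rwa [ha] at hS
  simpa only [hw, hμ k M, hβ] using hk S hS'

/-- **Transport of the upper pin (b″)** (same weights, upper pin masses read `c` higher:
`m_crit' + a M / Z_m' = m_crit + a (M + c) / Z_m`, thresholds `M₀ ≤ M₀' + c`). -/
theorem upperPin_transport (h : UpperPin Nf reg M₀ m R) (c : ℝ) (ha : ∀ k, reg'.a k = reg.a k)
    (hβ : ∀ k, reg'.β k = reg.β k)
    (hw : ∀ k f, reg'.mcrit k + reg'.a k * m' f / reg'.Zm k = reg.mcrit k + reg.a k * m f / reg.Zm k)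
    (hμ : ∀ k M, reg'.mcrit k + reg'.a k * M / reg'.Zm k = reg.mcrit k + reg.a k * (M + c) / reg.Zm k)
    (hc : M₀ ≤ M₀' + c) : UpperPin Nf reg' M₀' m' R := by
  intro M hM
  have hM' : M₀ < M + c := by linarith
  filter_upwards [h (M + c) hM'] with k hk S hS hS2
  have hS' : R ≤ reg.a k * (2 * S + 1) := by rwa [ha] at hS
  have hS2' : reg.a k * (2 * S + 1) ≤ 2 * R := by rwa [ha] at hS2
  simpa only [hw, hμ k M, hβ] using hk S hS' hS2'

end Transport

/-! ## The zero-threshold pin of a re-centred regularisation, in un-recentred coordinates -/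

section Recentre

variable {Nf : ℕ} (reg₁ : QCDRegularisation Nf) (J : ℝ)

/-- **Re-centring at `J`, read backwards.**  The two-sided pin at ZERO threshold of `reg₁` re-centred at the germ `J`
(weights at the positive tuple `m`) follows from — and by the same bookkeeping is equivalent to — the lower pin of
`reg₁` at every depth `> −J` and the upper pin of `reg₁` at every height `> J`, both with weights at `J + m`, on a
common `R`.  (With `reg₁ := reg.restrict φ _` the conclusion is literally that of `stub_jumpGerm`.) -/
theorem zeroPin_recentre_of {m : Fin Nf → ℝ} {R : ℝ}
    (hb : PinClause Nf reg₁ (-J) (fun f => J + m f) R) (hu : UpperPin Nf reg₁ J (fun f => J + m f) R) :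
    PinClause Nf (QCDRegularisation.mk reg₁.a reg₁.a_pos reg₁.tendsto_a reg₁.β reg₁.L reg₁.tendsto_L
        (fun k => reg₁.mcrit k + reg₁.a k * J / reg₁.Zm k) reg₁.Zm reg₁.Zm_pos) 0 m R ∧
      UpperPin Nf (QCDRegularisation.mk reg₁.a reg₁.a_pos reg₁.tendsto_a reg₁.β reg₁.L reg₁.tendsto_L
        (fun k => reg₁.mcrit k + reg₁.a k * J / reg₁.Zm k) reg₁.Zm reg₁.Zm_pos) 0 m R := by
  constructor
  · refine pinClause_transport hb J (fun _ => rfl) (fun _ => rfl) (fun k f => ?_) (fun k M => ?_) (by linarith)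
    · show reg₁.mcrit k + reg₁.a k * J / reg₁.Zm k + reg₁.a k * m f / reg₁.Zm k =
        reg₁.mcrit k + reg₁.a k * (J + m f) / reg₁.Zm k
      ring
    · show reg₁.mcrit k + reg₁.a k * J / reg₁.Zm k - reg₁.a k * M / reg₁.Zm k =
        reg₁.mcrit k - reg₁.a k * (M - J) / reg₁.Zm k
      ring
  · refine upperPin_transport hu J (fun _ => rfl) (fun _ => rfl) (fun k f => ?_) (fun k M => ?_) (by linarith)
    · show reg₁.mcrit k + reg₁.a k * J / reg₁.Zm k + reg₁.a k * m f / reg₁.Zm k =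
        reg₁.mcrit k + reg₁.a k * (J + m f) / reg₁.Zm k
      ring
    · show reg₁.mcrit k + reg₁.a k * J / reg₁.Zm k + reg₁.a k * M / reg₁.Zm k =
        reg₁.mcrit k + reg₁.a k * (M + J) / reg₁.Zm k
      ring

end Recentre

/-! ## What the hypotheses of the stub DO give: the germ `J = M₀` along `φ = id`, modulo the lower pin in the band -/

/-- **B2a from the lower pin through the band.**  If, for every tuple `m > M₀`, some `R > 0` carries the LOWER pin of
`reg` from depth `−M₀` on (`PinClause Nf reg (−M₀) m R`: `P(Re det D_W(m_crit − a M'/Z_m) < 0) ≥ 1/4` for every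
`M' > −M₀`, i.e. at every mass below the upper edge `m_crit + a M₀/Z_m` of the band — the threshold package only gives
`M' > M₀`) together with the upper pin above `M₀`, then `φ = id` and the germ `J = M₀` (the upper edge of the band)
carry the two-sided pin at zero threshold. -/
theorem jumpGerm_of_bandLowerPin {Nf : ℕ} (reg : QCDRegularisation Nf) (M₀ : ℝ)
    (h : ∀ m : Fin Nf → ℝ, (∀ f, M₀ < m f) → ∃ R : ℝ, 0 < R ∧ PinClause Nf reg (-M₀) m R ∧ UpperPin Nf reg M₀ m R) :
    ∃ (φ : ℕ → ℕ) (hφ : StrictMono φ) (J : ℝ), ∀ m : Fin Nf → ℝ, (∀ f, 0 < m f) → ∃ R : ℝ, 0 < R ∧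
      PinClause Nf (QCDRegularisation.mk (reg.restrict φ hφ.tendsto_atTop).a (reg.restrict φ hφ.tendsto_atTop).a_pos
        (reg.restrict φ hφ.tendsto_atTop).tendsto_a (reg.restrict φ hφ.tendsto_atTop).β (reg.restrict φ hφ.tendsto_atTop).L
        (reg.restrict φ hφ.tendsto_atTop).tendsto_L (fun k => (reg.restrict φ hφ.tendsto_atTop).mcrit k +
          (reg.restrict φ hφ.tendsto_atTop).a k * J / (reg.restrict φ hφ.tendsto_atTop).Zm k)
        (reg.restrict φ hφ.tendsto_atTop).Zm (reg.restrict φ hφ.tendsto_atTop).Zm_pos) 0 m R ∧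
      UpperPin Nf (QCDRegularisation.mk (reg.restrict φ hφ.tendsto_atTop).a (reg.restrict φ hφ.tendsto_atTop).a_pos
        (reg.restrict φ hφ.tendsto_atTop).tendsto_a (reg.restrict φ hφ.tendsto_atTop).β (reg.restrict φ hφ.tendsto_atTop).L
        (reg.restrict φ hφ.tendsto_atTop).tendsto_L (fun k => (reg.restrict φ hφ.tendsto_atTop).mcrit k +
          (reg.restrict φ hφ.tendsto_atTop).a k * J / (reg.restrict φ hφ.tendsto_atTop).Zm k)
        (reg.restrict φ hφ.tendsto_atTop).Zm (reg.restrict φ hφ.tendsto_atTop).Zm_pos) 0 m R := by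
  refine ⟨id, strictMono_id, M₀, fun m hm => ?_⟩
  obtain ⟨R, hR, hb, hu⟩ := h (fun f => M₀ + m f) fun f => lt_add_of_pos_right M₀ (hm f)
  -- `reg.restrict id _` has the data of `reg` definitionally (`reg.a ∘ id`, …), so the pins of `reg` are its pins
  exact ⟨R, hR, zeroPin_recentre_of (reg.restrict id strictMono_id.tendsto_atTop) M₀
    (fun M hM => hb M hM) (fun M hM => hu M hM)⟩

/-- **The stub at zero threshold (`M₀ = 0`), outright**: `φ = id`, `J = 0` (the re-centring is by `a_k · 0 / Z_m = 0`).
Exactly the registered signature of `stub_jumpGerm` with `M₀` specialised to `0` (the scalings, the weak branch and the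
body are not used). -/
theorem jumpGerm_of_zeroThreshold : ∀ Nf : ℕ, (Nf = 2 ∨ Nf = 3) → ∀ reg : QCDRegularisation Nf, reg.HasMassScaling →
    (reg.scheme 0 0 0).HasAsymptoticScaling → (∀ᶠ k : ℕ in atTop, -1 ≤ reg.mcrit k) →
    (∀ m : Fin Nf → ℝ, (∀ f, 0 < m f) → ∃ R : ℝ, 0 < R ∧ PinClause Nf reg 0 m R ∧ UpperPin Nf reg 0 m R) →
    (∀ m : Fin Nf → ℝ, (∀ f, 0 < m f) → ∃ (z shift : QCDField Nf → ℕ → ℝ) (T : OSData (QCDField Nf) 4),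
      IsQCDAlong (reg.scheme m z shift) T ∧ T.IsNontrivial QCDField.glue ∧ T.IsNonGaussian QCDField.glue ∧
        (∀ f g : Fin Nf, f ≠ g → T.IsNontrivial (QCDField.pseudoRe f g)) ∧
          ∃ Δ > 0, T.HasMassGap Δ ∧ (reg.scheme m z shift).HasLatticeMassGap Δ) →
    ∃ (φ : ℕ → ℕ) (hφ : StrictMono φ) (J : ℝ), ∀ m : Fin Nf → ℝ, (∀ f, 0 < m f) → ∃ R : ℝ, 0 < R ∧
      PinClause Nf (QCDRegularisation.mk (reg.restrict φ hφ.tendsto_atTop).a (reg.restrict φ hφ.tendsto_atTop).a_pos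
        (reg.restrict φ hφ.tendsto_atTop).tendsto_a (reg.restrict φ hφ.tendsto_atTop).β (reg.restrict φ hφ.tendsto_atTop).L
        (reg.restrict φ hφ.tendsto_atTop).tendsto_L (fun k => (reg.restrict φ hφ.tendsto_atTop).mcrit k +
          (reg.restrict φ hφ.tendsto_atTop).a k * J / (reg.restrict φ hφ.tendsto_atTop).Zm k)
        (reg.restrict φ hφ.tendsto_atTop).Zm (reg.restrict φ hφ.tendsto_atTop).Zm_pos) 0 m R ∧
      UpperPin Nf (QCDRegularisation.mk (reg.restrict φ hφ.tendsto_atTop).a (reg.restrict φ hφ.tendsto_atTop).a_pos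
        (reg.restrict φ hφ.tendsto_atTop).tendsto_a (reg.restrict φ hφ.tendsto_atTop).β (reg.restrict φ hφ.tendsto_atTop).L
        (reg.restrict φ hφ.tendsto_atTop).tendsto_L (fun k => (reg.restrict φ hφ.tendsto_atTop).mcrit k +
          (reg.restrict φ hφ.tendsto_atTop).a k * J / (reg.restrict φ hφ.tendsto_atTop).Zm k)
        (reg.restrict φ hφ.tendsto_atTop).Zm (reg.restrict φ hφ.tendsto_atTop).Zm_pos) 0 m R := by
  intro Nf _ reg _ _ _ hpin _
  refine jumpGerm_of_bandLowerPin reg 0 fun m hm => ?_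
  obtain ⟨R, hR, hb, hu⟩ := hpin m hm
  exact ⟨R, hR, (neg_zero (G := ℝ)).symm ▸ hb, hu⟩


end Summit.QuantumFields.QCD.Theorems.LightQuarkJumpLine

end
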